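import Mathlib
import HarnessLib
import Summits.HubbardSuperconductivity.HubbardSuperconductivity.Theorems.KLProgrammeC4aCausticWindowCover

/-!
# Route `KLProgramme` — crux C4a, S3 brick (B4) «(B4)-UMK1», «(M4)-COVER» part 2: the TRANSVERSAL near-caustic window — ONE SIGN of the configuration rate on the
# box from the Gauss floor (connectedness; no zero located) and the two-point separation `κ|ϑ − ϑ′| ≤ |δ₀(ϑ) − δ₀(ϑ′)|` of the caustic offset

Cell `gate-hubbard-kl`, seat hubbard-kl-k3c3-p3 (g30; row «implicit-function / monotonicity route for μ(n)»).  Located brick for the (C)-closer lane hubbard-kl-c4a-1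
(stub (C) `stub_twoLeg_curvature` of `KLRegimeEngineV17F2`, stmt-HubbardSuperconductivity-20437), memo HOME/hubbard-kl-k3c3-p3/U1-CAUSTIC-SUP.md §9 (3)(b).
Part 1 (`…C4aCausticWindowCover`) gives the pointwise floor `κ(η, Δ, |ρ|) ≤ |R(ϑ,φ)|` of the configuration rate
`R(ϑ,φ) = De_K(c + Φ(ρ,ϑ+θ) − Φ(0,φ+θ))[∂_sΦ(ρ,ϑ+θ)]` on a box carrying the `hΔ` row and the angular separation `η`.  This file:
* §1 `hasDerivAt_partnerBand_base` (the rate IS the `ϑ`-derivative, free base point `c`), `continuous_configRate` (joint continuity);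
* §2 **`sign_of_abs_ge_of_isPreconnected`** (a continuous function with `κ ≤ |R|`, `κ > 0`, on a preconnected set is `≥ κ` or `≤ −κ` throughout — intermediate
  value theorem; the (M4) assembly never locates a zero of the rate) and **`abs_windowMin_sub_ge_of_signed_rate`** (a window minimum with an existential
  minimiser inherits a SIGNED rate as a two-point separation — monotonicity only, the pattern of `…C4aCausticOffsetRate.abs_min_value_sub_ge` without a
  selection function);
* §3 **`abs_windowMin_sub_ge_of_transversal`** / **`_sInf`**: under `GeomConstants (frameLevel μ K) Kc r₀ g₀ w` (= `FrameOK` (i)), `|ρ| < r, r₀`, the `hΔ` row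
  (`Δ ≤ 3/10`, `K₁Δ < r`), `η ≤ min(‖ψ − (ϑ+θ)‖_𝕋, ‖ψ − (ϑ+θ) − π‖_𝕋)` on `[α,β]` and `κ(η,Δ,|ρ|) > 0`:  `κ|ϑ − ϑ′| ≤ |m ϑ − m ϑ′|` for the window minimum
  `m` of the partner band over `[φa,φb]` (existential minimiser, or the canonical `sInf` with attainment discharged) — EXACTLY the `hsep` of
  `…C4aCausticWindowDispatchTransversal.intervalIntegral_caustic_dispatch_transversal_le`.
Sizes binder shape; pure calculus/bookkeeping on landed rows; nothing about the model's sizes; nothing asserts (C), K3 or superconductivity.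
References: BGM 2003 §7.1 Lemma 7.1 (A1.9) [cite: BenfattoGiulianiMastropietro2003]; FST II CPAM 51 (1998) §3 [cite: FeldmanSalmhoferTrubowitz1998].
-/

noncomputable section

namespace Summit.HubbardSuperconductivity.HubbardSuperconductivity.Theorems.C4a

set_option linter.dupNamespace false -- summit = problem name (single-conjunct summit), D-0017

open Real Set
open Literature.MathematicalPhysics.QuantumLattice Literature.MathematicalPhysics.QuantumLattice.BandSectorCounting
open Literature.MathematicalPhysics.QuantumLattice.FermiRG
open Summit.HubbardSuperconductivity.HubbardSuperconductivity.Theorems.KLRegimeSplit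
open Summit.HubbardSuperconductivity.HubbardSuperconductivity.Theorems.DispersionFlow
open Summit.HubbardSuperconductivity.HubbardSuperconductivity.Theorems.PerturbedFermiCurve

/-! ## §2 One sign from a floor; separation of a window minimum from a signed rate (binder-free) -/

/-- **ONE SIGN from a floor** (connectedness; no zero is located): a function continuous on a preconnected set with `κ ≤ |R|`, `κ > 0`, is `≥ κ` everywhere
or `≤ −κ` everywhere. -/
theorem sign_of_abs_ge_of_isPreconnected {S : Set (ℝ × ℝ)} (hS : IsPreconnected S) {R : ℝ × ℝ → ℝ} (hcont : ContinuousOn R S) {κ : ℝ} (hκ : 0 < κ)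
    (hfloor : ∀ x ∈ S, κ ≤ |R x|) : (∀ x ∈ S, κ ≤ R x) ∨ (∀ x ∈ S, R x ≤ -κ) := by
  by_cases h : ∀ x ∈ S, R x ≤ 0
  · right
    intro x hx
    have h1 := hfloor x hx
    rw [abs_of_nonpos (h x hx)] at h1
    linarith
  · left
    push Not at h
    obtain ⟨x₀, hx₀, hpos⟩ := h
    intro x hx
    by_contra hlt
    push Not at hlt
    have hneg : R x ≤ 0 := by
      have h1 := hfloor x hx
      by_contra hp
      push Not at hp
      rw [abs_of_pos hp] at h1
      linarith
    obtain ⟨z, hz, hz0⟩ := hS.intermediate_value hx hx₀ hcont ⟨hneg, hpos.le⟩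
    have h1 := hfloor z hz
    rw [hz0, abs_zero] at h1
    linarith

/-- **SEPARATION OF A WINDOW MINIMUM from a SIGNED rate** (monotonicity only, existential minimiser): if for every `φ ∈ W` the slices `t ↦ g t φ` all increase at rate
`≥ κ` on `I`, or all decrease at rate `≥ κ`, and `m t` is the minimum of `g t ·` over `W` attained in `W`, then `κ|t − t′| ≤ |m t − m t′|` on `I`. -/
theorem abs_windowMin_sub_ge_of_signed_rate {g : ℝ → ℝ → ℝ} {m : ℝ → ℝ} {I W : Set ℝ} {κ : ℝ}
    (hrate : (∀ φ ∈ W, ∀ t ∈ I, ∀ t' ∈ I, t' ≤ t → κ * (t - t') ≤ g t φ - g t' φ) ∨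
      (∀ φ ∈ W, ∀ t ∈ I, ∀ t' ∈ I, t' ≤ t → κ * (t - t') ≤ g t' φ - g t φ))
    (hmle : ∀ t ∈ I, ∀ φ ∈ W, m t ≤ g t φ) (hmex : ∀ t ∈ I, ∃ φ ∈ W, m t = g t φ) :
    ∀ t ∈ I, ∀ t' ∈ I, κ * |t - t'| ≤ |m t - m t'| := by
  -- the ordered case
  have key : ∀ t ∈ I, ∀ t' ∈ I, t' ≤ t → κ * (t - t') ≤ |m t - m t'| := by
    intro t ht t' ht' htt'
    obtain ⟨φ, hφ, hmt⟩ := hmex t ht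
    obtain ⟨φ', hφ', hmt'⟩ := hmex t' ht'
    rcases hrate with h | h
    · have h1 := h φ hφ t ht t' ht' htt'
      have h2 := hmle t' ht' φ hφ
      have h3 : κ * (t - t') ≤ m t - m t' := by rw [hmt]; linarith
      exact h3.trans (le_abs_self _)
    · have h1 := h φ' hφ' t ht t' ht' htt'
      have h2 := hmle t ht φ' hφ'
      have h3 : κ * (t - t') ≤ -(m t - m t') := by rw [hmt']; linarith
      exact h3.trans (neg_le_abs _)
  intro t ht t' ht'
  rcases le_total t' t with h | h
  · rw [abs_of_nonneg (sub_nonneg.2 h)]; exact key t ht t' ht' h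
  · rw [abs_sub_comm t t', abs_of_nonneg (sub_nonneg.2 h), abs_sub_comm (m t) (m t')]; exact key t' ht' t ht h

/-! ## §1, §3 The rate as a derivative, its continuity, and the transversal window -/

section Sizes

variable {K : TrigPolyC4v} {A : ℝ} (hA : ∀ p : Momentum, ∀ j ≤ 2, ‖iteratedFDeriv ℝ j (frameShift K) p‖ ≤ A)
  (hd : klCurveD ≤ (bandBounds (show (-4 : ℝ) < -1.1 by norm_num) (show (-1.1 : ℝ) ≤ -0.1 by norm_num)
    (show (-0.1 : ℝ) < 0 by norm_num)).Dtmin - 2 * A)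
  {μ r : ℝ} (hlo : (-1.1 : ℝ) < μ - r - A) (hhi : μ + r + A < -0.1)
  {K₁ : ℝ} (hK₁ : ∀ p : Momentum, ‖fderiv ℝ (frameLevel μ K) p‖ ≤ K₁)
include hA hd hlo hhi hK₁

omit hK₁ in
/-- The configuration rate is the `ϑ`-derivative of the partner band (chain rule; twin of `hasDerivAt_partnerBand_config` for a free base point `c`). -/
theorem hasDerivAt_partnerBand_base (c : Momentum) {ρ : ℝ} (hρ : |ρ| < r) (θ φ ϑ : ℝ) :
    HasDerivAt (fun t : ℝ => frameLevel μ K (c + (levelPoint μ K ρ (t + θ) - levelPoint μ K 0 (φ + θ))))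
      (fderiv ℝ (frameLevel μ K) (c + (levelPoint μ K ρ (ϑ + θ) - levelPoint μ K 0 (φ + θ)))
        (iteratedDeriv 1 (levelPoint μ K ρ) (ϑ + θ))) ϑ := by
  have hq : HasDerivAt (fun t : ℝ => levelPoint μ K ρ (t + θ)) (iteratedDeriv 1 (levelPoint μ K ρ) (ϑ + θ)) ϑ :=
    HasDerivAt.comp_add_const ϑ θ (hasDerivAt_levelPoint_angle hA hd hlo hhi hρ (ϑ + θ))
  have hS : HasDerivAt (fun t : ℝ => c + (levelPoint μ K ρ (t + θ) - levelPoint μ K 0 (φ + θ)))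
      (iteratedDeriv 1 (levelPoint μ K ρ) (ϑ + θ)) ϑ := by
    have h := (hq.sub_const (levelPoint μ K 0 (φ + θ))).const_add c
    exact h
  have hE : DifferentiableAt ℝ (frameLevel μ K) (c + (levelPoint μ K ρ (ϑ + θ) - levelPoint μ K 0 (φ + θ))) :=
    ((EngineV8.contDiff_frameLevel μ K (n := 1)).differentiable one_ne_zero) _
  exact hE.hasFDerivAt.comp_hasDerivAt ϑ hS

omit hK₁ in
/-- The configuration rate is jointly continuous in `(ϑ, φ)`. -/
theorem continuous_configRate (c : Momentum) {ρ : ℝ} (hρ : |ρ| < r) (θ : ℝ) :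
    Continuous fun x : ℝ × ℝ => fderiv ℝ (frameLevel μ K) (c + (levelPoint μ K ρ (x.1 + θ) - levelPoint μ K 0 (x.2 + θ)))
      (iteratedDeriv 1 (levelPoint μ K ρ) (x.1 + θ)) := by
  have hr' : 0 < r := lt_of_le_of_lt (abs_nonneg ρ) hρ
  have h0 : |(0 : ℝ)| < r := by simpa using hr'
  have hcρ : Continuous (levelPoint μ K ρ) := (contDiff_levelPoint_of_sizes hA hd hlo hhi hρ 0).continuous
  have hc0 : Continuous (levelPoint μ K 0) := (contDiff_levelPoint_of_sizes hA hd hlo hhi h0 0).continuous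
  have hP : Continuous fun x : ℝ × ℝ => c + (levelPoint μ K ρ (x.1 + θ) - levelPoint μ K 0 (x.2 + θ)) :=
    continuous_const.add ((hcρ.comp (continuous_fst.add continuous_const)).sub (hc0.comp (continuous_snd.add continuous_const)))
  have hF : Continuous (fderiv ℝ (frameLevel μ K)) := (EngineV8.contDiff_frameLevel μ K (n := 1)).continuous_fderiv one_ne_zero
  have hv : Continuous fun x : ℝ × ℝ => iteratedDeriv 1 (levelPoint μ K ρ) (x.1 + θ) :=
    ((contDiff_levelPoint_of_sizes hA hd hlo hhi hρ 2).continuous_iteratedDeriv 1 (by norm_num)).comp (continuous_fst.add continuous_const)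
  exact (hF.comp hP).clm_apply hv

/-- **THE TRANSVERSAL WINDOW: SEPARATION OF THE CAUSTIC OFFSET** (existential minimiser).  Under `GeomConstants (frameLevel μ K) Kc r₀ g₀ w`, `|ρ| < r`, `|ρ| < r₀`,
base point `c`, base angle `θ`, reference angle `ψ`, box `[α,β] × [φa,φb]` with the `hΔ` row (`Δ ≤ 3/10`, `K₁Δ < r`) and the ANGULAR SEPARATION
`η ≤ min(‖ψ − (ϑ+θ)‖_𝕋, ‖ψ − (ϑ+θ) − π‖_𝕋)` on `[α,β]` with
`0 < κ := (2/π)(Dt−2A)u_min·((u_min w/(4+2A))(η − (π/(2u_min))Δ) − πKc(K₁Δ + |ρ|)/(Dt−2A)²)`; `m ϑ` = a minimum of `φ ↦ e_K(c + Φ(ρ,ϑ+θ) − Φ(0,φ+θ))` over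
`[φa,φb]` attained there.  THEN `κ|ϑ − ϑ′| ≤ |m ϑ − m ϑ′|` on `[α,β]` — the `hsep` of `intervalIntegral_caustic_dispatch_transversal_le`; the sign of the rate is
decided internally, no crossing is located. -/
theorem abs_windowMin_sub_ge_of_transversal {Kc r₀ g₀ w : ℝ} (hG : GeomConstants (frameLevel μ K) Kc r₀ g₀ w) {ρ : ℝ} (hρ : |ρ| < r) (hρ₀ : |ρ| < r₀)
    (c : Momentum) (θ ψ : ℝ) {α β φa φb Δ η : ℝ}
    (hΔ : ∀ x ∈ Icc α β ×ˢ Icc φa φb, ‖c + (levelPoint μ K ρ (x.1 + θ) - levelPoint μ K 0 (x.2 + θ)) - levelPoint μ K 0 ψ‖ ≤ Δ)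
    (hΔ1 : Δ ≤ 3 / 10) (hΔr : K₁ * Δ < r)
    (hη : ∀ ϑ ∈ Icc α β, η ≤ min (torusDist (ψ - (ϑ + θ))) (torusDist (ψ - (ϑ + θ) - π)))
    (hκ : 0 < 2 / π * (((bandBounds (show (-4 : ℝ) < -1.1 by norm_num) (show (-1.1 : ℝ) ≤ -0.1 by norm_num) (show (-0.1 : ℝ) < 0 by norm_num)).Dtmin - 2 * A) *
        (bandBounds (show (-4 : ℝ) < -1.1 by norm_num) (show (-1.1 : ℝ) ≤ -0.1 by norm_num) (show (-0.1 : ℝ) < 0 by norm_num)).umin) *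
      ((bandBounds (show (-4 : ℝ) < -1.1 by norm_num) (show (-1.1 : ℝ) ≤ -0.1 by norm_num) (show (-0.1 : ℝ) < 0 by norm_num)).umin * w /
            (4 + 2 * A) *
          (η - π / (2 * (bandBounds (show (-4 : ℝ) < -1.1 by norm_num) (show (-1.1 : ℝ) ≤ -0.1 by norm_num) (show (-0.1 : ℝ) < 0 by norm_num)).umin) * Δ) -
        π * Kc * (K₁ * Δ + |ρ|) / ((bandBounds (show (-4 : ℝ) < -1.1 by norm_num) (show (-1.1 : ℝ) ≤ -0.1 by norm_num)
          (show (-0.1 : ℝ) < 0 by norm_num)).Dtmin - 2 * A) ^ 2))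
    {m : ℝ → ℝ}
    (hmle : ∀ ϑ ∈ Icc α β, ∀ φ ∈ Icc φa φb, m ϑ ≤ frameLevel μ K (c + (levelPoint μ K ρ (ϑ + θ) - levelPoint μ K 0 (φ + θ))))
    (hmex : ∀ ϑ ∈ Icc α β, ∃ φ ∈ Icc φa φb, m ϑ = frameLevel μ K (c + (levelPoint μ K ρ (ϑ + θ) - levelPoint μ K 0 (φ + θ)))) :
    ∀ ϑ ∈ Icc α β, ∀ ϑ' ∈ Icc α β,
      2 / π * (((bandBounds (show (-4 : ℝ) < -1.1 by norm_num) (show (-1.1 : ℝ) ≤ -0.1 by norm_num) (show (-0.1 : ℝ) < 0 by norm_num)).Dtmin - 2 * A) *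
        (bandBounds (show (-4 : ℝ) < -1.1 by norm_num) (show (-1.1 : ℝ) ≤ -0.1 by norm_num) (show (-0.1 : ℝ) < 0 by norm_num)).umin) *
      ((bandBounds (show (-4 : ℝ) < -1.1 by norm_num) (show (-1.1 : ℝ) ≤ -0.1 by norm_num) (show (-0.1 : ℝ) < 0 by norm_num)).umin * w /
            (4 + 2 * A) *
          (η - π / (2 * (bandBounds (show (-4 : ℝ) < -1.1 by norm_num) (show (-1.1 : ℝ) ≤ -0.1 by norm_num) (show (-0.1 : ℝ) < 0 by norm_num)).umin) * Δ) -
        π * Kc * (K₁ * Δ + |ρ|) / ((bandBounds (show (-4 : ℝ) < -1.1 by norm_num) (show (-1.1 : ℝ) ≤ -0.1 by norm_num)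
          (show (-0.1 : ℝ) < 0 by norm_num)).Dtmin - 2 * A) ^ 2) * |ϑ - ϑ'| ≤ |m ϑ - m ϑ'| := by
  set B := bandBounds (show (-4 : ℝ) < -1.1 by norm_num) (show (-1.1 : ℝ) ≤ -0.1 by norm_num) (show (-0.1 : ℝ) < 0 by norm_num) with hBdef
  set κ : ℝ := 2 / π * ((B.Dtmin - 2 * A) * B.umin) *
      (B.umin * w / (4 + 2 * A) * (η - π / (2 * B.umin) * Δ) - π * Kc * (K₁ * Δ + |ρ|) / (B.Dtmin - 2 * A) ^ 2) with hκdef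
  -- the family, its rate, the floor on the box
  set g : ℝ → ℝ → ℝ := fun ϑ φ => frameLevel μ K (c + (levelPoint μ K ρ (ϑ + θ) - levelPoint μ K 0 (φ + θ))) with hg
  set R : ℝ × ℝ → ℝ := fun x => fderiv ℝ (frameLevel μ K) (c + (levelPoint μ K ρ (x.1 + θ) - levelPoint μ K 0 (x.2 + θ)))
      (iteratedDeriv 1 (levelPoint μ K ρ) (x.1 + θ)) with hR
  have hfloor : ∀ x ∈ Icc α β ×ˢ Icc φa φb, κ ≤ |R x| := fun x hx =>
    abs_configRate_ge_of_near hA hd hlo hhi hK₁ hG (hΔ x hx) hΔ1 hΔr hρ hρ₀ (hη x.1 hx.1)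
  -- one sign on the (convex, hence preconnected) box
  have hpre : IsPreconnected (Icc α β ×ˢ Icc φa φb) := ((convex_Icc α β).prod (convex_Icc φa φb)).isPreconnected
  have hcont : ContinuousOn R (Icc α β ×ˢ Icc φa φb) := (continuous_configRate hA hd hlo hhi c hρ θ).continuousOn
  have hsign := sign_of_abs_ge_of_isPreconnected hpre hcont hκ hfloor
  -- slices: derivative `R (s, φ)` at every `s`
  have hderiv : ∀ φ s : ℝ, HasDerivAt (fun t => g t φ) (R (s, φ)) s := fun φ s => hasDerivAt_partnerBand_base hA hd hlo hhi c hρ θ φ s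
  have hslice_cont : ∀ φ : ℝ, ∀ a b : ℝ, ContinuousOn (fun t => g t φ) (Icc a b) := fun φ a b s _ =>
    (hderiv φ s).differentiableAt.continuousAt.continuousWithinAt
  have hslice_diff : ∀ φ : ℝ, ∀ a b : ℝ, DifferentiableOn ℝ (fun t => g t φ) (interior (Icc a b)) := fun φ a b s _ =>
    (hderiv φ s).differentiableAt.differentiableWithinAt
  -- signed increments
  have hrate : (∀ φ ∈ Icc φa φb, ∀ t ∈ Icc α β, ∀ t' ∈ Icc α β, t' ≤ t → κ * (t - t') ≤ g t φ - g t' φ) ∨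
      (∀ φ ∈ Icc φa φb, ∀ t ∈ Icc α β, ∀ t' ∈ Icc α β, t' ≤ t → κ * (t - t') ≤ g t' φ - g t φ) := by
    rcases hsign with h | h
    · left
      intro φ hφ t ht t' ht' htt'
      have hge : ∀ s ∈ interior (Icc t' t), κ ≤ deriv (fun t => g t φ) s := fun s hs => by
        have hs' : s ∈ Icc t' t := interior_subset hs
        rw [(hderiv φ s).deriv]
        exact h (s, φ) ⟨⟨ht'.1.trans hs'.1, hs'.2.trans ht.2⟩, hφ⟩
      exact (convex_Icc t' t).mul_sub_le_image_sub_of_le_deriv (hslice_cont φ t' t) (hslice_diff φ t' t) hge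
        t' (left_mem_Icc.2 htt') t (right_mem_Icc.2 htt') htt'
    · right
      intro φ hφ t ht t' ht' htt'
      have hle : ∀ s ∈ interior (Icc t' t), deriv (fun t => g t φ) s ≤ -κ := fun s hs => by
        have hs' : s ∈ Icc t' t := interior_subset hs
        rw [(hderiv φ s).deriv]
        exact h (s, φ) ⟨⟨ht'.1.trans hs'.1, hs'.2.trans ht.2⟩, hφ⟩
      have := (convex_Icc t' t).image_sub_le_mul_sub_of_deriv_le (hslice_cont φ t' t) (hslice_diff φ t' t) hle
        t' (left_mem_Icc.2 htt') t (right_mem_Icc.2 htt') htt'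
      linarith
  exact abs_windowMin_sub_ge_of_signed_rate hrate hmle hmex

/-- **THE SAME FOR THE CANONICAL OFFSET `δ₀(ϑ) = inf_{φ ∈ [φa,φb]} e_K(c + Φ(ρ,ϑ+θ) − Φ(0,φ+θ))`** (nonempty loop window): attainment and minimality discharged. -/
theorem abs_windowMin_sub_ge_of_transversal_sInf {Kc r₀ g₀ w : ℝ} (hG : GeomConstants (frameLevel μ K) Kc r₀ g₀ w) {ρ : ℝ} (hρ : |ρ| < r) (hρ₀ : |ρ| < r₀)
    (c : Momentum) (θ ψ : ℝ) {α β φa φb Δ η : ℝ} (hφ : φa ≤ φb)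
    (hΔ : ∀ x ∈ Icc α β ×ˢ Icc φa φb, ‖c + (levelPoint μ K ρ (x.1 + θ) - levelPoint μ K 0 (x.2 + θ)) - levelPoint μ K 0 ψ‖ ≤ Δ)
    (hΔ1 : Δ ≤ 3 / 10) (hΔr : K₁ * Δ < r)
    (hη : ∀ ϑ ∈ Icc α β, η ≤ min (torusDist (ψ - (ϑ + θ))) (torusDist (ψ - (ϑ + θ) - π)))
    (hκ : 0 < 2 / π * (((bandBounds (show (-4 : ℝ) < -1.1 by norm_num) (show (-1.1 : ℝ) ≤ -0.1 by norm_num) (show (-0.1 : ℝ) < 0 by norm_num)).Dtmin - 2 * A) *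
        (bandBounds (show (-4 : ℝ) < -1.1 by norm_num) (show (-1.1 : ℝ) ≤ -0.1 by norm_num) (show (-0.1 : ℝ) < 0 by norm_num)).umin) *
      ((bandBounds (show (-4 : ℝ) < -1.1 by norm_num) (show (-1.1 : ℝ) ≤ -0.1 by norm_num) (show (-0.1 : ℝ) < 0 by norm_num)).umin * w /
            (4 + 2 * A) *
          (η - π / (2 * (bandBounds (show (-4 : ℝ) < -1.1 by norm_num) (show (-1.1 : ℝ) ≤ -0.1 by norm_num) (show (-0.1 : ℝ) < 0 by norm_num)).umin) * Δ) -
        π * Kc * (K₁ * Δ + |ρ|) / ((bandBounds (show (-4 : ℝ) < -1.1 by norm_num) (show (-1.1 : ℝ) ≤ -0.1 by norm_num)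
          (show (-0.1 : ℝ) < 0 by norm_num)).Dtmin - 2 * A) ^ 2)) :
    ∀ ϑ ∈ Icc α β, ∀ ϑ' ∈ Icc α β,
      2 / π * (((bandBounds (show (-4 : ℝ) < -1.1 by norm_num) (show (-1.1 : ℝ) ≤ -0.1 by norm_num) (show (-0.1 : ℝ) < 0 by norm_num)).Dtmin - 2 * A) *
        (bandBounds (show (-4 : ℝ) < -1.1 by norm_num) (show (-1.1 : ℝ) ≤ -0.1 by norm_num) (show (-0.1 : ℝ) < 0 by norm_num)).umin) *
      ((bandBounds (show (-4 : ℝ) < -1.1 by norm_num) (show (-1.1 : ℝ) ≤ -0.1 by norm_num) (show (-0.1 : ℝ) < 0 by norm_num)).umin * w /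
            (4 + 2 * A) *
          (η - π / (2 * (bandBounds (show (-4 : ℝ) < -1.1 by norm_num) (show (-1.1 : ℝ) ≤ -0.1 by norm_num) (show (-0.1 : ℝ) < 0 by norm_num)).umin) * Δ) -
        π * Kc * (K₁ * Δ + |ρ|) / ((bandBounds (show (-4 : ℝ) < -1.1 by norm_num) (show (-1.1 : ℝ) ≤ -0.1 by norm_num)
          (show (-0.1 : ℝ) < 0 by norm_num)).Dtmin - 2 * A) ^ 2) * |ϑ - ϑ'| ≤
      |sInf ((fun φ => frameLevel μ K (c + (levelPoint μ K ρ (ϑ + θ) - levelPoint μ K 0 (φ + θ)))) '' Icc φa φb) -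
        sInf ((fun φ => frameLevel μ K (c + (levelPoint μ K ρ (ϑ' + θ) - levelPoint μ K 0 (φ + θ)))) '' Icc φa φb)| := by
  have hr' : 0 < r := lt_of_le_of_lt (abs_nonneg ρ) hρ
  have h0 : |(0 : ℝ)| < r := by simpa using hr'
  have hc0 : Continuous (levelPoint μ K 0) := (contDiff_levelPoint_of_sizes hA hd hlo hhi h0 0).continuous
  set g : ℝ → ℝ → ℝ := fun ϑ φ => frameLevel μ K (c + (levelPoint μ K ρ (ϑ + θ) - levelPoint μ K 0 (φ + θ))) with hg
  have hslice : ∀ ϑ : ℝ, ContinuousOn (g ϑ) (Icc φa φb) := fun ϑ =>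
    ((EngineV8.contDiff_frameLevel μ K (n := 0)).continuous.comp
      (continuous_const.add (continuous_const.sub (hc0.comp (continuous_id.add continuous_const))))).continuousOn
  have hmin : ∀ ϑ ∈ Icc α β, (∀ φ ∈ Icc φa φb, sInf (g ϑ '' Icc φa φb) ≤ g ϑ φ) ∧ ∃ φ ∈ Icc φa φb, sInf (g ϑ '' Icc φa φb) = g ϑ φ := fun ϑ _ => by
    obtain ⟨x, hx, hxeq, hxle⟩ := isCompact_Icc.exists_sInf_image_eq_and_le (nonempty_Icc.2 hφ) (hslice ϑ)
    exact ⟨fun φ hφ' => hxeq ▸ hxle φ hφ', x, hx, hxeq⟩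
  exact abs_windowMin_sub_ge_of_transversal hA hd hlo hhi hK₁ hG hρ hρ₀ c θ ψ hΔ hΔ1 hΔr hη hκ (m := fun ϑ => sInf (g ϑ '' Icc φa φb))
    (fun ϑ hϑ => (hmin ϑ hϑ).1) (fun ϑ hϑ => (hmin ϑ hϑ).2)
end Sizes

end Summit.HubbardSuperconductivity.HubbardSuperconductivity.Theorems.C4a

end
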